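import Summits.BirchSwinnertonDyer.BirchSwinnertonDyer.Theorems.ConjSpanGenAllLevels
import HarnessLib

/-!
# Route `PrintX11a`, crux U3 `UpperNonSurjThree` (item stmt-BirchSwinnertonDyer-20613), line finemu3 — μ-road stub
# `stub_muAnHardThree`: the ATKIN–LEHNER-EXTENDED ORBIT SETUP in `GL₂(ℤ[1/3])`, part 1/3 (objects, `Γ*`, normal form)

Cell `bsd-print-x11a`, width seat bsd-line-x11a-p2 g2 (`--supports stmt-BirchSwinnertonDyer-20613`). BSD is not proved by
any of this; nothing is asserted about any curve. Route-independent group theory (imports: the tree's THEOREM-B files only).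

WHY. The tree proves Greenberg's analytic `μ₃ = 0` input-free at GOOD ordinary `3`
(`AnalyticMuZeroThree.muAnZeroAt_three`: Vaserstein (V) over `ℤ[1/3]` ⟹ THEOREM B `ConjSpanGen N 3` (`3 ∤ N`, orbit
trick `ConjSpanGenAllLevels.OrbitTrick.mem_of_mem_closure` in `SL₂(ℤ[1/3])`) ⟹ Hecke bridge ⟹ non-constancy ⟹ unit
coefficient). At a MULTIPLICATIVE level `N = 3M` (`3 ∤ M`) the literal span statement is vacuous (`IsGoodAt 3` forces
`d = ±1` in `Γ₀(3M)`), and `Γ₀(3M)` has TWO orbits on `Δ·∞` and on `Δ·0` for `Δ = Γ₀(M; ℤ[1/3])` (the classes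
`[∞] ∪ [1/M]` and `[0] ∪ [1/3]` of `X₀(3M)`), so the tree's hypotheses (h3), (h3′) fail for `Γ = Γ₀(3M)`.  REPAIR (this
seat): pass to `G = GL₂(ℤ[1/3])` and `Γ* = ⟨Γ₀(3M), W⟩`, `W = w(3) = (3x, y; 3M, 3)` the Atkin–Lehner matrix
(`det W = 3`, a unit of `ℤ[1/3]`): `W` swaps `[∞] ↔ [1/M]` and `[0] ↔ [1/3]`, so `Γ*` IS transitive and the ABSTRACT
orbit lemma applies verbatim with `D* = {c ∈ M·ℤ[1/3]} ≤ GL₂`, `B* =` upper, `P* =` lower triangular.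

THIS FILE (1/3): `A = ℤ[1/3]`, `G = GL₂(A)`; the unit `3`, `s3 = 3·1`, `diag2 u v`; the integer matrix `Wint M x y`,
`ξ' = (x y; M 3) ∈ SL₂(ℤ)` (`3x − My = 1`), `W = mapGL ξ' · diag(3,1) ∈ G`; the subgroups `B*`, `P*_M`, `D*_M`;
`Γ* := ⟨mapGL Γ₀(N) ∪ {W}⟩`; and the NORMAL FORM `g = 3ᵏ · γ · Wⁱ` (`k ∈ ℤ`, `γ ∈ Γ₀(N)`, `i ∈ {0,1}`) of every
element of `Γ*`, from the two integer identities `γ^W · W = W · γ` (`W` normalises `Γ₀(N)`) and `W·W = 3·γ₀`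
(taken as hypotheses here; discharged from Knapp 1993 Lemma 9.24 in the companion analytic file).  Parts 2/3
(`…OrbitDecomposition`: coset splitting of `Γ₀(M)`, (h3), (h3′), Vaserstein transport) and 3/3 (`…OrbitKernel`: the
period subgroup `S`, (h1), (h2), the kernel theorem).  beyond-print: the multiplicative-level orbit trick is not in
print (nearest: Sun 2007 §4; Kim–Sun).  References: [Vaserstein1972SL2] Theorem; [Manin1972] Prop. 1.4;
[Knapp1993] Lemma 9.24, Thm. 9.27; [AtkinLehner1970] Lemmas 8–10, Thm. 3.
-/

set_option linter.dupNamespace false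
set_option autoImplicit false

namespace Summit.BirchSwinnertonDyer.BirchSwinnertonDyer.Theorems.MultThreeOrbit

open scoped MatrixGroups
open CongruenceSubgroup Matrix.SpecialLinearGroup
open Summit.BirchSwinnertonDyer.BirchSwinnertonDyer.Theorems.ConjSpanGenAllLevels
  Literature.NumberTheory.EllipticCurves.Rank1Residual

noncomputable section

/-- `A = ℤ[1/3]`. -/
abbrev A : Type := Away 3

/-- `G = GL₂(ℤ[1/3])`. -/
abbrev G : Type := GL (Fin 2) A

/-! ### The unit `3`, the scalar and diagonal matrices, and `W` -/

/-- `3` is a unit of `ℤ[1/3]`. [folklore] -/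
theorem isUnit_three : IsUnit ((3 : ℤ) : A) := by
  have h := IsLocalization.Away.algebraMap_isUnit (S := A) (3 : ℤ)
  simpa using h

/-- The unit `3 ∈ ℤ[1/3]ˣ`. [folklore] -/
def three : Aˣ := isUnit_three.unit

/-- The unit `3` coerces to `3`. [folklore] -/
@[simp] theorem coe_three : ((three : Aˣ) : A) = ((3 : ℤ) : A) := isUnit_three.unit_spec

/-- The scalar matrix `3·1 ∈ GL₂(ℤ[1/3])`. [folklore] -/
def s3 : G := Matrix.GeneralLinearGroup.scalar (Fin 2) three

/-- The diagonal matrix `diag(u, v) ∈ GL₂(ℤ[1/3])` for units `u, v`. [folklore] -/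
def diag2 (u v : Aˣ) : G :=
  ⟨!![(u : A), 0; 0, (v : A)], !![((u⁻¹ : Aˣ) : A), 0; 0, ((v⁻¹ : Aˣ) : A)],
    by
      ext i j
      fin_cases i <;> fin_cases j <;> simp [Matrix.mul_apply, Fin.sum_univ_two],
    by
      ext i j
      fin_cases i <;> fin_cases j <;> simp [Matrix.mul_apply, Fin.sum_univ_two]⟩

/-- Entry `(0,0)` of `diag(u,v)`. [folklore] -/
@[simp] theorem diag2_apply_00 (u v : Aˣ) : (diag2 u v : G) 0 0 = (u : A) := rfl
/-- Entry `(0,1)` of `diag(u,v)`. [folklore] -/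
@[simp] theorem diag2_apply_01 (u v : Aˣ) : (diag2 u v : G) 0 1 = 0 := rfl
/-- Entry `(1,0)` of `diag(u,v)`. [folklore] -/
@[simp] theorem diag2_apply_10 (u v : Aˣ) : (diag2 u v : G) 1 0 = 0 := rfl
/-- Entry `(1,1)` of `diag(u,v)`. [folklore] -/
@[simp] theorem diag2_apply_11 (u v : Aˣ) : (diag2 u v : G) 1 1 = (v : A) := rfl

/-- `det diag(u, v) = u v`. [folklore] -/
theorem det_diag2 (u v : Aˣ) : Matrix.GeneralLinearGroup.det (diag2 u v) = u * v := by
  ext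
  rw [Matrix.GeneralLinearGroup.val_det_apply, Units.val_mul]
  show Matrix.det !![(u : A), 0; 0, (v : A)] = _
  rw [Matrix.det_fin_two_of]; ring

/-- The diagonal matrix `diag(3, 1) ∈ GL₂(ℤ[1/3])`. [folklore] -/
abbrev d31 : G := diag2 three 1

section Setup

variable (M : ℕ) (x y : ℤ)

/-- The INTEGER Atkin–Lehner matrix `W = (3x, y; 3M, 3)` (determinant `3` when `3x − My = 1`). [folklore] -/
def Wint : Matrix (Fin 2) (Fin 2) ℤ := !![3 * x, y; 3 * (M : ℤ), 3]

variable {M x y}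

/-- `ξ' = (x, y; M, 3) ∈ SL(2, ℤ)` (`3x − My = 1`); `W = ξ' · diag(3, 1)`. [folklore] -/
def xiSL (hbez : 3 * x - M * y = 1) : SL(2, ℤ) :=
  ⟨!![x, y; (M : ℤ), 3], by rw [Matrix.det_fin_two_of]; linear_combination hbez⟩

/-- `W ∈ GL₂(ℤ[1/3])`: `W = ξ' · diag(3, 1)`. [folklore] -/
def WA (hbez : 3 * x - M * y = 1) : G := mapGL A (xiSL hbez) * d31

/-- The matrix of `W ∈ GL₂(ℤ[1/3])` is the cast of `Wint`. [folklore] -/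
theorem coe_WA (hbez : 3 * x - M * y = 1) :
    ((WA hbez : G) : Matrix (Fin 2) (Fin 2) A) = (Wint M x y).map (Int.castRingHom A : ℤ → A) := by
  rw [WA, Matrix.GeneralLinearGroup.coe_mul, Matrix.SpecialLinearGroup.mapGL_coe_matrix, xiSL, Wint]
  ext i j
  fin_cases i <;> fin_cases j <;> simp [Matrix.mul_apply, Fin.sum_univ_two, diag2] <;> ring

end Setup

/-! ### Entries of inverses in `GL₂` -/

/-- `(g⁻¹)₁₀ = −det(g)⁻¹ · g₁₀`. [folklore] -/
theorem inv_apply_one_zero (g : G) :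
    ((g⁻¹ : G) : Matrix (Fin 2) (Fin 2) A) 1 0 = -(Ring.inverse (g : Matrix (Fin 2) (Fin 2) A).det * g 1 0) := by
  rw [Matrix.GeneralLinearGroup.coe_inv, Matrix.inv_def, Matrix.adjugate_fin_two, Matrix.smul_apply,
    smul_eq_mul]
  have h : (!![(g : Matrix (Fin 2) (Fin 2) A) 1 1, -(g : Matrix (Fin 2) (Fin 2) A) 0 1;
      -(g : Matrix (Fin 2) (Fin 2) A) 1 0, (g : Matrix (Fin 2) (Fin 2) A) 0 0] : Matrix (Fin 2) (Fin 2) A) 1 0 =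
      -(g : Matrix (Fin 2) (Fin 2) A) 1 0 := rfl
  rw [h]; ring

/-- `(g⁻¹)₀₁ = −det(g)⁻¹ · g₀₁`. [folklore] -/
theorem inv_apply_zero_one (g : G) :
    ((g⁻¹ : G) : Matrix (Fin 2) (Fin 2) A) 0 1 = -(Ring.inverse (g : Matrix (Fin 2) (Fin 2) A).det * g 0 1) := by
  rw [Matrix.GeneralLinearGroup.coe_inv, Matrix.inv_def, Matrix.adjugate_fin_two, Matrix.smul_apply,
    smul_eq_mul]
  have h : (!![(g : Matrix (Fin 2) (Fin 2) A) 1 1, -(g : Matrix (Fin 2) (Fin 2) A) 0 1;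
      -(g : Matrix (Fin 2) (Fin 2) A) 1 0, (g : Matrix (Fin 2) (Fin 2) A) 0 0] : Matrix (Fin 2) (Fin 2) A) 0 1 =
      -(g : Matrix (Fin 2) (Fin 2) A) 0 1 := rfl
  rw [h]; ring

/-! ### The subgroups `B* = Stab(∞)`, `P* = Stab(0) ∩ D*`, `D* = Γ₀(M; ℤ[1/3])` of `GL₂(ℤ[1/3])` -/

/-- `B*`: upper-triangular elements of `GL₂(ℤ[1/3])`. -/
def upperGL : Subgroup G where
  carrier := {g | g 1 0 = 0}
  mul_mem' := by
    intro g h hg hh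
    simp only [Set.mem_setOf_eq] at hg hh ⊢
    rw [Matrix.GeneralLinearGroup.coe_mul, Matrix.mul_apply, Fin.sum_univ_two, hg, hh]; ring
  one_mem' := by simp
  inv_mem' := by
    intro g hg
    simp only [Set.mem_setOf_eq] at hg ⊢
    rw [inv_apply_one_zero, hg]; ring

/-- `P*_M`: lower-triangular elements of `GL₂(ℤ[1/3])` with lower-left entry in `M·ℤ[1/3]`. -/
def lowerGL (M : ℕ) : Subgroup G where
  carrier := {g | g 0 1 = 0 ∧ ∃ t : A, g 1 0 = (M : A) * t}
  mul_mem' := by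
    rintro g h ⟨hg, t, ht⟩ ⟨hh, s, hs⟩
    refine ⟨?_, t * h 0 0 + g 1 1 * s, ?_⟩
    · rw [Matrix.GeneralLinearGroup.coe_mul, Matrix.mul_apply, Fin.sum_univ_two, hg, hh]; ring
    · rw [Matrix.GeneralLinearGroup.coe_mul, Matrix.mul_apply, Fin.sum_univ_two, ht, hs]; ring
  one_mem' := ⟨by simp, 0, by simp⟩
  inv_mem' := by
    rintro g ⟨hg, t, ht⟩
    refine ⟨?_, -(Ring.inverse (g : Matrix (Fin 2) (Fin 2) A).det * t), ?_⟩
    · rw [inv_apply_zero_one, hg]; ring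
    · rw [inv_apply_one_zero, ht]; ring

/-- `D*_M = Γ₀(M; ℤ[1/3])` inside `GL₂(ℤ[1/3])`: lower-left entry in `M·ℤ[1/3]` (ANY unit determinant). -/
def DeltaGL (M : ℕ) : Subgroup G where
  carrier := {g | ∃ t : A, g 1 0 = (M : A) * t}
  mul_mem' := by
    rintro g h ⟨t, ht⟩ ⟨s, hs⟩
    refine ⟨t * h 0 0 + g 1 1 * s, ?_⟩
    rw [Matrix.GeneralLinearGroup.coe_mul, Matrix.mul_apply, Fin.sum_univ_two, ht, hs]; ring
  one_mem' := ⟨0, by simp⟩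
  inv_mem' := by
    rintro g ⟨t, ht⟩
    refine ⟨-(Ring.inverse (g : Matrix (Fin 2) (Fin 2) A).det * t), ?_⟩
    rw [inv_apply_one_zero, ht]; ring

/-- `B* ≤ D*`. [folklore] -/
theorem upperGL_le_DeltaGL (M : ℕ) : upperGL ≤ DeltaGL M := by
  intro g hg
  exact ⟨0, by rw [show (g : Matrix (Fin 2) (Fin 2) A) 1 0 = 0 from hg]; ring⟩

/-- `P* ≤ D*`. [folklore] -/
theorem lowerGL_le_DeltaGL (M : ℕ) : lowerGL M ≤ DeltaGL M := fun _ hg => hg.2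

/-- Diagonal matrices are upper triangular. [folklore] -/
theorem diag2_mem_upperGL (u v : Aˣ) : diag2 u v ∈ upperGL := by
  show (diag2 u v : G) 1 0 = 0
  rfl

/-- Diagonal matrices are lower triangular. [folklore] -/
theorem diag2_mem_lowerGL (M : ℕ) (u v : Aˣ) : diag2 u v ∈ lowerGL M :=
  ⟨rfl, 0, by simp⟩

/-- The image of `B⁺ ⊆ SL₂(ℤ[1/3])` lies in `B*`. -/
theorem toGL_mem_upperGL {b : SL(2, A)} (hb : b ∈ upperB 3) : (toGL b : G) ∈ upperGL := hb

/-- The image of `B⁻_M ⊆ SL₂(ℤ[1/3])` lies in `P*_M`. -/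
theorem toGL_mem_lowerGL {M : ℕ} {q : SL(2, A)} (hq : q ∈ lowerP 3 M) : (toGL q : G) ∈ lowerGL M := hq

/-- Scalars `3ᵏ` lie in `D*`. [folklore] -/
theorem s3_zpow_mem_DeltaGL (M : ℕ) (k : ℤ) : s3 ^ k ∈ DeltaGL M :=
  (DeltaGL M).zpow_mem ⟨0, by simp [s3]⟩ k


/-! ### `Γ* = ⟨Γ₀(N), W⟩ ≤ GL₂(ℤ[1/3])` and its normal form `3ᵏ · γ · Wⁱ` -/

section GammaStar

variable {N M : ℕ} {x y : ℤ} (hbez : 3 * x - M * y = 1)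

/-- `s3` is central. [folklore] -/
theorem s3_zpow_mul_comm (k : ℤ) (g : G) : s3 ^ k * g = g * s3 ^ k := by
  have h : Commute (s3 : G) g := Matrix.GeneralLinearGroup.scalar_commute three g
  exact (h.zpow_left k).eq

/-- Entries of `mapGL A γ` are the casts of the entries of `γ`. [folklore] -/
theorem coe_mapGL_int (γ : SL(2, ℤ)) :
    ((mapGL A γ : G) : Matrix (Fin 2) (Fin 2) A) = (γ : Matrix (Fin 2) (Fin 2) ℤ).map (Int.castRingHom A : ℤ → A) := by
  ext i j; simp

/-- `Γ* := ⟨mapGL Γ₀(N) ∪ {W}⟩ ≤ GL₂(ℤ[1/3])`. -/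
def GammaStar (N : ℕ) (hbez : 3 * x - M * y = 1) : Subgroup G :=
  Subgroup.closure (Set.range (fun γ : Gamma0 N ↦ (mapGL A (γ : SL(2, ℤ)) : G)) ∪ {WA hbez})

/-- `mapGL γ ∈ Γ*`. [folklore] -/
theorem mapGL_mem_GammaStar (γ : Gamma0 N) : (mapGL A (γ : SL(2, ℤ)) : G) ∈ GammaStar N hbez :=
  Subgroup.subset_closure (Or.inl ⟨γ, rfl⟩)

/-- `W ∈ Γ*`. [folklore] -/
theorem WA_mem_GammaStar : WA hbez ∈ GammaStar N hbez :=
  Subgroup.subset_closure (Or.inr rfl)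

/-- `3·1 ∈ Γ*` once `W² = 3 γ₀`. [folklore] -/
theorem s3_mem_GammaStar_of (γ₀ : Gamma0 N) (h : WA hbez * WA hbez = s3 * mapGL A (γ₀ : SL(2, ℤ))) :
    (s3 : G) ∈ GammaStar N hbez := by
  have : (s3 : G) = WA hbez * WA hbez * (mapGL A (γ₀ : SL(2, ℤ)))⁻¹ := by rw [h, mul_inv_cancel_right]
  rw [this]
  exact mul_mem (mul_mem (WA_mem_GammaStar hbez) (WA_mem_GammaStar hbez))
    (inv_mem (mapGL_mem_GammaStar hbez γ₀))

/-- `algebraMap ℤ A`-cast of an integer matrix identity `γ' W = W γ` to `GL₂(ℤ[1/3])`. [folklore] -/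
theorem mapGL_mul_WA_eq {γ γ' : SL(2, ℤ)}
    (h : (γ' : Matrix (Fin 2) (Fin 2) ℤ) * Wint M x y = Wint M x y * (γ : Matrix (Fin 2) (Fin 2) ℤ)) :
    (mapGL A γ' : G) * WA hbez = WA hbez * mapGL A γ := by
  rw [← Units.val_inj, Units.val_mul, Units.val_mul, coe_WA, coe_mapGL_int, coe_mapGL_int,
    ← RingHom.mapMatrix_apply, ← RingHom.mapMatrix_apply, ← RingHom.mapMatrix_apply, ← map_mul,
    ← map_mul, h]

/-- Cast of `W W = 3 γ₀` to `GL₂(ℤ[1/3])`: `W W = (3·1) γ₀`. [folklore] -/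
theorem WA_mul_WA_eq {γ₀ : SL(2, ℤ)}
    (h : Wint M x y * Wint M x y = (3 : ℤ) • (γ₀ : Matrix (Fin 2) (Fin 2) ℤ)) :
    WA hbez * WA hbez = s3 * (mapGL A γ₀ : G) := by
  rw [← Units.val_inj, Units.val_mul, Units.val_mul, coe_WA, coe_mapGL_int, ← RingHom.mapMatrix_apply,
    ← RingHom.mapMatrix_apply, ← map_mul, h, s3, Matrix.GeneralLinearGroup.coe_scalar, coe_three,
    map_zsmul, RingHom.mapMatrix_apply, Matrix.scalar_apply, ← Matrix.smul_eq_diagonal_mul]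
  ext i j
  simp [Matrix.smul_apply]

variable (hconj : ∀ γ : Gamma0 N, ∃ γ' : Gamma0 N,
    ((γ' : SL(2, ℤ)) : Matrix (Fin 2) (Fin 2) ℤ) * Wint M x y = Wint M x y * ((γ : SL(2, ℤ)) : Matrix _ _ ℤ))
  (hsq : ∃ γ₀ : Gamma0 N, Wint M x y * Wint M x y = (3 : ℤ) • ((γ₀ : SL(2, ℤ)) : Matrix (Fin 2) (Fin 2) ℤ))
include hconj hsq

/-- **Normal form**: every element of `Γ*` is `3ᵏ · γ · Wⁱ` (`W γ = γ^W W`, `W² = 3 γ₀`). [folklore] -/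
theorem exists_normalForm_of_mem {g : G} (hg : g ∈ GammaStar N hbez) :
    ∃ (k : ℤ) (γ : Gamma0 N) (i : ℕ), i ≤ 1 ∧ g = s3 ^ k * mapGL A (γ : SL(2, ℤ)) * WA hbez ^ i := by
  obtain ⟨γ₀, hγ₀⟩ := hsq
  have hWW : WA hbez * WA hbez = s3 * (mapGL A (γ₀ : SL(2, ℤ)) : G) := WA_mul_WA_eq hbez hγ₀
  have hWinv : (WA hbez)⁻¹ = s3 ^ (-1 : ℤ) * (mapGL A ((γ₀⁻¹ : Gamma0 N) : SL(2, ℤ)) : G) * WA hbez := by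
    have h1 : (s3 * (mapGL A (γ₀ : SL(2, ℤ)) : G))⁻¹ * (WA hbez * WA hbez) = 1 := by
      rw [hWW, inv_mul_cancel]
    calc (WA hbez)⁻¹ = (s3 * (mapGL A (γ₀ : SL(2, ℤ)) : G))⁻¹ * (WA hbez * WA hbez) * (WA hbez)⁻¹ := by
          rw [h1, one_mul]
      _ = (s3 * (mapGL A (γ₀ : SL(2, ℤ)) : G))⁻¹ * WA hbez := by rw [mul_assoc, mul_inv_cancel_right]
      _ = s3 ^ (-1 : ℤ) * (mapGL A ((γ₀⁻¹ : Gamma0 N) : SL(2, ℤ)) : G) * WA hbez := by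
          rw [mul_inv_rev, Subgroup.coe_inv, map_inv]
          congr 1
          have h2 := s3_zpow_mul_comm (-1) ((mapGL A (γ₀ : SL(2, ℤ)) : G)⁻¹)
          rw [zpow_neg_one] at h2 ⊢
          exact h2.symm
  refine Subgroup.closure_induction (p := fun g _ ↦
    ∃ (k : ℤ) (γ : Gamma0 N) (i : ℕ), i ≤ 1 ∧ g = s3 ^ k * mapGL A (γ : SL(2, ℤ)) * WA hbez ^ i)
    ?_ ?_ ?_ ?_ hg
  · rintro g (⟨γ, rfl⟩ | rfl)
    · exact ⟨0, γ, 0, zero_le_one, by simp⟩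
    · exact ⟨0, 1, 1, le_rfl, by simp⟩
  · exact ⟨0, 1, 0, zero_le_one, by simp⟩
  · rintro g h - - ⟨k, γ, i, hi, rfl⟩ ⟨l, γ', j, hj, rfl⟩
    interval_cases i
    · refine ⟨k + l, γ * γ', j, hj, ?_⟩
      simp only [pow_zero, mul_one, Subgroup.coe_mul, map_mul, zpow_add, mul_assoc]
      rw [← mul_assoc (mapGL A (γ : SL(2, ℤ)) : G) (s3 ^ l), ← s3_zpow_mul_comm l, mul_assoc]
    · obtain ⟨γ'', hγ''⟩ := hconj γ'
      have hc : WA hbez * (mapGL A (γ' : SL(2, ℤ)) : G) = mapGL A (γ'' : SL(2, ℤ)) * WA hbez :=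
        (mapGL_mul_WA_eq hbez hγ'').symm
      interval_cases j
      · refine ⟨k + l, γ * γ'', 1, le_rfl, ?_⟩
        simp only [pow_zero, mul_one, pow_one, Subgroup.coe_mul, map_mul, zpow_add, mul_assoc]
        rw [← mul_assoc (WA hbez) (s3 ^ l), ← s3_zpow_mul_comm l (WA hbez), mul_assoc, hc,
          ← mul_assoc (mapGL A (γ : SL(2, ℤ)) : G) (s3 ^ l), ← s3_zpow_mul_comm l, mul_assoc]
      · refine ⟨k + l + 1, γ * γ'' * γ₀, 0, zero_le_one, ?_⟩
        simp only [pow_zero, mul_one, pow_one, Subgroup.coe_mul, map_mul, zpow_add, zpow_one, mul_assoc]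
        rw [← mul_assoc (WA hbez) (s3 ^ l), ← s3_zpow_mul_comm l (WA hbez), mul_assoc,
          ← mul_assoc (WA hbez) (mapGL A (γ' : SL(2, ℤ)) : G), hc, mul_assoc, hWW,
          ← mul_assoc (mapGL A (γ : SL(2, ℤ)) : G) (s3 ^ l), ← s3_zpow_mul_comm l, mul_assoc,
          ← mul_assoc (mapGL A (γ'' : SL(2, ℤ)) : G) s3, ← zpow_one s3, ← s3_zpow_mul_comm 1, mul_assoc,
          ← mul_assoc (mapGL A (γ : SL(2, ℤ)) : G) (s3 ^ (1 : ℤ)), ← s3_zpow_mul_comm 1, mul_assoc]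
  · rintro g - ⟨k, γ, i, hi, rfl⟩
    interval_cases i
    · refine ⟨-k, γ⁻¹, 0, zero_le_one, ?_⟩
      simp only [pow_zero, mul_one, mul_inv_rev, Subgroup.coe_inv, map_inv, ← zpow_neg]
      rw [s3_zpow_mul_comm]
    · obtain ⟨γ'', hγ''⟩ := hconj γ⁻¹
      have hc : WA hbez * (mapGL A ((γ⁻¹ : Gamma0 N) : SL(2, ℤ)) : G) = mapGL A (γ'' : SL(2, ℤ)) * WA hbez :=
        (mapGL_mul_WA_eq hbez hγ'').symm
      refine ⟨-k + -1, γ₀⁻¹ * γ'', 1, le_rfl, ?_⟩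
      simp only [pow_one, mul_inv_rev, Subgroup.coe_mul, map_mul, zpow_add]
      rw [hWinv, ← map_inv, ← Subgroup.coe_inv, ← zpow_neg]
      simp only [mul_assoc]
      rw [← mul_assoc (WA hbez) (mapGL A ((γ⁻¹ : Gamma0 N) : SL(2, ℤ)) : G) (s3 ^ (-k)), hc,
        mul_assoc (mapGL A (γ'' : SL(2, ℤ)) : G) (WA hbez) (s3 ^ (-k)), ← s3_zpow_mul_comm (-k) (WA hbez),
        ← mul_assoc (mapGL A (γ'' : SL(2, ℤ)) : G) (s3 ^ (-k)), ← s3_zpow_mul_comm (-k), mul_assoc,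
        ← mul_assoc (mapGL A ((γ₀⁻¹ : Gamma0 N) : SL(2, ℤ)) : G) (s3 ^ (-k)), ← s3_zpow_mul_comm (-k),
        mul_assoc, ← mul_assoc (s3 ^ (-1 : ℤ)) (s3 ^ (-k)), ← zpow_add, add_comm, zpow_add, mul_assoc]

omit hconj hsq in
/-- Normal forms lie in `Γ*` (given `3·1 ∈ Γ*`). [folklore] -/
theorem mem_of_normalForm (hs3 : (s3 : G) ∈ GammaStar N hbez) (k : ℤ) (γ : Gamma0 N) (i : ℕ) :
    s3 ^ k * mapGL A (γ : SL(2, ℤ)) * WA hbez ^ i ∈ GammaStar N hbez := by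
  exact mul_mem (mul_mem (Subgroup.zpow_mem _ hs3 k) (mapGL_mem_GammaStar hbez γ))
    (pow_mem (WA_mem_GammaStar hbez) i)

end GammaStar

end

end Summit.BirchSwinnertonDyer.BirchSwinnertonDyer.Theorems.MultThreeOrbit
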